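import Summits.QuantumFields.BalabanUV.Beta.FP.TorusCompositeSlice
import Summits.QuantumFields.BalabanUV.Beta.FP.TorusCompositeObjectsG

/-!
# `BalabanUV.Beta.FP.TorusCompositeSliceG` — road «FP» for binder row D1, ROUTE T, (β1) re-basing (the ROW OWNER an2 g52's RULING R-D1-g52-1, journal
# l.56283; the OWNER d1-p3 g29's R-FP-69 (b) name list l.56319; leaf-06 g32 W-2 l.56339, item G-1; leaf-02 g31 W-1 l.56632; the OWNER d1-p3 g31's RULING
# R-FP-71 FINAL «DISPLAY WHAT YOU USE» l.58350, W-FP-31-1 FINAL): **`hTW^{(n)}` OVER AN ABSTRACT ONE-STEP ROW FAMILY** — the GENERIC twin of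
# `FP/TorusCompositeSlice` §1 (`det_nestedSlice_mul_towerGen_ne_zero ∕ det_fromRows_… ∕ torus_hTW_tower`, leaf-06 g21), with the ONE kernel input (leaf-02's
# composite covariance row `c0`) DISPLAYED (§1, the universal family — g32's v1.1 §1 BYTE-IDENTICAL), the same induction AT ONE CONSTANT ROOT LIST with the
# constant-list row displayed (§2), and its (0.4)-SYMMETRISED instance at the CENTRED constant root list (§3, W-1's located shape = W-FP-31-1 FINAL's wanted
# statement); NO landed byte moved (the rooted theorems stay as they are)

WHAT.  `TorusCompositeSlice.det_nestedSlice_mul_towerGen_ne_zero` proves `det (nestedSlice Lc M lev rs n * towerGen Lc M rs n) ≠ 0` by induction on the depth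
from three ingredients: the kernel-free top block `det (combF · (σ • D̄)) ≠ 0` (`det_combF_mul_smul_tgrad_res_ne_zero`), the depth-1 generic
`NestedStepLawOneShotLetters.det_nestedSlice_mul_gauge_ne_zero`, and leaf-02's ROOTED c0-tower `TorusCompositeCovariance.compRows_mul_towerGen_succ`
(`compRows … (n+1) * towerGen … (n+1) = fromCols (σ_{n+1} • D̄) 0`, whose kernel input is `bhKStepAt`'s gauge covariance).  Since `nestedSlice ∕ compRows` ARE
`nestedSliceG ∕ compRowsG` at `Q := Qstep Lc` (`TorusCompositeObjectsG` §2), the SAME induction proves the statement for ANY step-row family `Q : StepRows d Lc`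
once c0 is DISPLAYED as a hypothesis on `compRowsG Lc Q` — §1 **`det_nestedSliceG_mul_towerGen_ne_zero (Q) (σ) (hσ) (hc0)`** (`σ lev m` any non-vanishing
scalar family; leaf-02's is `∏_{i<m} stepScale d Lc (lev (i+1)) · #B`; `hc0` the UNIVERSAL family `∀ n M lev rs, (∀ k, rs k ∈ box) → …` — a HYPOTHESIS, met at
`Q := Qstep Lc` by the rooted `compRows_mul_towerGen_succ` for every in-block root list; the rooted file's three theorems are that instance, not re-stated —
dedup; a NOT-TO-FILE junction cert re-derives them), with the two call spellings `det_fromRows_combF_compRowsG_nestedSliceG_mul_towerGen_ne_zero` and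
`torus_hTW_towerG` (binders `hQ₁₀ : Q₁₀ = compRowsG Lc Q …`, `hτ₁ : τ₁ = nestedSliceG Lc Q …`, `hτ₂`, `hW₀` VERBATIM up to `G`) — §1 IS g32's v1.1 §1 (W-FP-31-1
FINAL: «UNCHANGED — the universal family is a HYPOTHESIS there and the rooted `compRows_mul_towerGen_succ` meets it; it stays the rooted-generic discharger»;
the road's `-G` files no longer call it — R-FP-71 FINAL displays its CONCLUSION `hSL`).  §2 THE SAME INDUCTION AT ONE CONSTANT ROOT LIST `fun _ => r` (a
root-free kernel whose combs sit at ONE in-block offset `r` at every storey — the tails of a constant list are itself up to `β`): **`det_nestedSliceG_mul_towerGen_ne_zero_const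
(Q) (σ) (hσ) (r) (hr) (hc0r)`** with the CONSTANT-LIST row `hc0r : ∀ n M lev, compRowsG Lc Q M lev (fun _ => r) (n+1) * towerGen Lc M (fun _ => r) (n+1) =
fromCols (σ lev (n+1) • D̄) 0` displayed, and `torus_hTW_towerG_const` (the call's spelling at `rs := fun _ => r`).  §3 THE (0.4)-SYMMETRISED INSTANCE AT THE
CENTRED ROOT LIST `fun _ => ctrOff (d+1) Lc` (leaf-02 g31 W-1, located; the OWNER CONCURS, R-FP-71: `QSym` IGNORES the root slot — the kernel's combs are
CENTRED — so the sym covariance row holds for the comb geometry rooted at `ctrOff (d+1) Lc` at every storey and is FALSE as a universal in the root list;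
v1.1's universal sym display was unsatisfiable — REPAIRED: W-FP-31-1 FINAL's wanted statement): **`det_nestedSliceSym_mul_towerGen_ne_zero`** and
**`torus_hTW_towerSym`** = §2 at `Q := QSym Lc`, `r := ctrOff (d+1) Lc` (`hr := ctrOff_mem_box`), `σ :=` leaf-02's product, with the sym c0 **`hc0 : ∀ n M lev,
compRowsSym Lc M lev (fun _ => ctrOff (d+1) Lc) (n+1) * towerGen Lc M (fun _ => ctrOff (d+1) Lc) (n+1) = fromCols (σ_{n+1} • D̄) 0`** DISPLAYED — the statement
leaf-02 g32's R-20 `TorusCompositeCovarianceSym.compRowsSym_mul_towerGen_succ` PROVES (INTENT-20 l.58384, shape (A): discharged by `fun n M _ lev =>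
compRowsSym_mul_towerGen_succ Lc hc n M lev`); this is the road's sym `hSL` discharger at `(n, fine Lc M′, lev ∘ succ)` (R-FP-71 FINAL (1)).  §2 of
`TorusCompositeSlice` (`torus_t1 ∕ t2_tower_of_c1 ∕ c2`) is ALREADY generic (any `Q₁₀ Q₁₁ W₀ W₁`) and needs no twin.
[folklore] linear algebra BY NAME over OUR bookkeeping objects; no `def`, no `def … : Prop`, nothing cited, 0 sorry, default heartbeats; nothing of the
dictionary ∕ Bałaban's asserted (the presentation is the ROW's ruling; whether the sym rows satisfy c0 at the centred roots is leaf-02's theorem, displayed).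

HONEST DEPENDENCY (page 1, mandatory): continuum YM on T⁴ ⇐ BetaPertH ∧ nine spine estimates (0/9 proved); BetaPertH ⇐ (D1) ∧ (D4) ∧ CAP+tail;
G-an2-4 gates asym, D1 and NE2/3/4.  HONEST FRAMING (cell contract, verbatim): «discharging `BetaPertH` makes Bałaban's UV stability UNCONDITIONAL —
a real constructive-QFT result; it is NOT the continuum limit and NOT the Clay problem.»  ABSOLUTE RULE (cell charter, verbatim): «No internally-minted
statement may enter as a cited fact. Every hypothesis is either kernel-proved in this package or a verbatim quotation of a PUBLISHED theorem with page
reference. The manuscript(s) under audit are NOT citable for their own disputed steps — they are the thing under adjudication; programme-internal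
(2001/route/tribunal) claims are never citable.»  0 estimates; 0∕4 row-D1 binders (hW, hR, D1Tel, D1Rep); NOT (C1), NOT (T-ID)∕(T-β) complete, NOT SDF,
NOT D1, NOT BetaPertH, NOT continuum, NOT Clay.  D1 formalisation swarm LEAF PROVER 06 (b2b-balaban-beta-d1-formalise-leaf-06 gen 32 ∕ gen 34), 2026-08-24.
No existing file touched.
-/
noncomputable section

open scoped BigOperators

namespace Summit.QuantumFields.BalabanUV.Beta.FP.TorusCompositeSliceG

open Matrix Finset
open Literature.MathematicalPhysics.QuantumFieldTheory.Balaban1983to89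
open Literature.MathematicalPhysics.QuantumFieldTheory.Balaban1983to89.Beta
open B5Prop11Plancherel (fine)
open B6Lemma24Torus (pbox)
open AffineAveraging (Site box toSite)
open AveragingContoursRooted (ctrOff ctrOff_mem_box)
open OneStepResolventKernel (Fib)
open Summit.QuantumFields.BalabanUV.Beta.BorderedHessian (stepScale)
open Summit.QuantumFields.BalabanUV.Beta.FP.KernelPeriodisationFib (Idx)
open Summit.QuantumFields.BalabanUV.Beta.FP.TorusGaugeCovariance (tgrad)
open Summit.QuantumFields.BalabanUV.Beta.FP.TorusGaugeCovarianceCoarse (tgradBlock)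
open Summit.QuantumFields.BalabanUV.Beta.FP.TorusCombRows (Res)
open Summit.QuantumFields.BalabanUV.Beta.FP.NestedStepLawOneShotLetters (det_ne_zero_of_abs_det det_nestedSlice_mul_gauge_ne_zero)
open Summit.QuantumFields.BalabanUV.Beta.FP.NestedStepLawTorusInstance (dvd_fine)
open Summit.QuantumFields.BalabanUV.Beta.FP.TorusCompositeObjects (towerTorus towerTorus_fine_eq_fine bigRatio pboxCongr combF NParam towerGen)
open Summit.QuantumFields.BalabanUV.Beta.FP.TorusCompositeObjectsG (StepRows compRowsG nestedSliceG QstepSym QSym compRowsSym nestedSliceSym)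
open Summit.QuantumFields.BalabanUV.Beta.FP.TorusCompositeSlice (abs_det_combF_mul_tgrad_res_eq_one det_combF_mul_smul_tgrad_res_ne_zero
  prod_stepScale_mul_card_ne_zero)

variable {d : ℕ}

/-! ## §1 `hTW^{(n)}` over an abstract one-step row family, the composite covariance row `c0` displayed -/

section Generic

variable (Lc : ℕ) [NeZero Lc] (Q : StepRows d Lc) (σ : (ℕ → ℕ) → ℕ → ℝ) (hσ : ∀ lev m, σ lev m ≠ 0)
  (hc0 : ∀ (n : ℕ) (M : Fin (d + 1) → ℕ) [∀ μ, NeZero (M μ)] (lev : ℕ → ℕ) (rs : ℕ → (Fin (d + 1) → ℕ)), (∀ k, rs k ∈ box (d + 1) Lc) →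
    compRowsG Lc Q M lev rs (n + 1) * towerGen Lc M rs (n + 1)
      = Matrix.fromCols
          (σ lev (n + 1) • (tgrad M).submatrix (fun a : ↥(pbox M) × Fin (d + 1) => ((a.1, Sum.inl a.2) : Idx M (Fib d)))
            (fun t : Res (toSite (rs 0)) Lc M => (t.1 : ↥(pbox M))))
          (0 : Matrix (↥(pbox M) × Fin (d + 1)) (NParam Lc (fine Lc M) (fun k => rs (k + 1)) n) ℝ))
include hσ hc0

/-- [folklore] **`hTW^{(n)}` OVER `Q` — THE GENERIC NESTED COMB SLICE AGAINST THE TOWER GENERATORS IS NON-DEGENERATE AT EVERY DEPTH**, for ANY step-row family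
`Q` whose composite rows obey the covariance row `c0` (`hc0`: the `(n+1)`-fold composite kills the lower levels' gauge modes and descends the top block-constant
modes to `σ lev (n+1) • D̄`, `σ` non-vanishing — `hσ`): `det (nestedSliceG Lc Q M lev rs n * towerGen Lc M rs n) ≠ 0` (`Lc ∣ M i`, in-block roots).  The rooted
file's induction VERBATIM with `compRows ∕ nestedSlice ↦ compRowsG Q ∕ nestedSliceG Q` and leaf-02's c0 ↦ `hc0`. -/
theorem det_nestedSliceG_mul_towerGen_ne_zero :
    ∀ (n : ℕ) (M : Fin (d + 1) → ℕ) [∀ μ, NeZero (M μ)] (lev : ℕ → ℕ) (rs : ℕ → (Fin (d + 1) → ℕ)),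
      (∀ k, rs k ∈ box (d + 1) Lc) → (∀ i, Lc ∣ M i) → (nestedSliceG Lc Q M lev rs n * towerGen Lc M rs n).det ≠ 0
  | 0, M, _, lev, rs, hrs, hM =>
    det_ne_zero_of_abs_det (abs_det_combF_mul_tgrad_res_eq_one Lc M (hrs 0) hM) one_ne_zero
  | n + 1, M, _, lev, rs, hrs, hM => by
    have ih := det_nestedSliceG_mul_towerGen_ne_zero n (fine Lc M) (fun k => lev (k + 1)) (fun k => rs (k + 1)) (fun k => hrs (k + 1)) (dvd_fine M)
    have htop := det_combF_mul_smul_tgrad_res_ne_zero Lc M (hrs 0) hM (hσ lev (n + 1))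
    have c0 := hc0 n M lev rs hrs
    exact det_nestedSlice_mul_gauge_ne_zero
      (nestedSliceG Lc Q (fine Lc M) (fun k => lev (k + 1)) (fun k => rs (k + 1)) n) (combF Lc M (rs 0)) (compRowsG Lc Q M lev rs (n + 1))
      (towerGen Lc (fine Lc M) (fun k => rs (k + 1)) n)
      ((tgradBlock M (bigRatio Lc n)).submatrix
        (fun b : ↥(pbox (towerTorus Lc (fine Lc M) n)) × Fin (d + 1) =>
          ((pboxCongr (towerTorus_fine_eq_fine Lc M n) b.1, Sum.inl b.2) : Idx (fine (bigRatio Lc n) M) (Fib d)))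
        (Subtype.val : Res (toSite (rs 0)) Lc M → ↥(pbox M)))
      (σ lev (n + 1) • (tgrad M).submatrix (fun a : ↥(pbox M) × Fin (d + 1) => ((a.1, Sum.inl a.2) : Idx M (Fib d)))
          (fun t : Res (toSite (rs 0)) Lc M => (t.1 : ↥(pbox M))))
      (Matrix.ext fun a y => congrFun (congrFun c0 a) (Sum.inr y))
      (Matrix.ext fun a t => congrFun (congrFun c0 a) (Sum.inl t))
      rfl rfl (abs_ne_zero.mpr ih) (abs_ne_zero.mpr htop)

/-- [folklore] **`hTW` AT DEPTH `n+1` OVER `Q`, IN THE CALL's SPELLING**: `det (fromRows (combF Lc M′ (rs 0) * compRowsG Lc Q M′ lev rs (n+1)) (nestedSliceG Lc Q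
(fine Lc M′) … n) * towerGen Lc M′ rs (n+1)) ≠ 0` — the `fromRows` IS `nestedSliceG Lc Q M′ lev rs (n+1)` (`nestedSliceG_succ`, `rfl`). -/
theorem det_fromRows_combF_compRowsG_nestedSliceG_mul_towerGen_ne_zero (M' : Fin (d + 1) → ℕ) [∀ μ, NeZero (M' μ)] (lev : ℕ → ℕ)
    (rs : ℕ → (Fin (d + 1) → ℕ)) (hrs : ∀ k, rs k ∈ box (d + 1) Lc) (hM' : ∀ i, Lc ∣ M' i) (n : ℕ) :
    (Matrix.fromRows (combF Lc M' (rs 0) * compRowsG Lc Q M' lev rs (n + 1))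
          (nestedSliceG Lc Q (fine Lc M') (fun k => lev (k + 1)) (fun k => rs (k + 1)) n)
        * towerGen Lc M' rs (n + 1)).det ≠ 0 :=
  det_nestedSliceG_mul_towerGen_ne_zero Lc Q σ hσ hc0 (n + 1) M' lev rs hrs hM'

/-- [folklore] **`hTW` OF THE GENERIC COMPOSITE CALL, BINDERS VERBATIM UP TO `G`**: `τ₂ Q₁₀ τ₁ W₀` pinned by `hτ₂ hQ₁₀ hτ₁ hW₀`; `(fromRows (τ₂ * Q₁₀) τ₁ * W₀).det ≠ 0`. -/
theorem torus_hTW_towerG (M' : Fin (d + 1) → ℕ) [∀ μ, NeZero (M' μ)] (lev : ℕ → ℕ) (rs : ℕ → (Fin (d + 1) → ℕ)) (n : ℕ)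
    (hrs : ∀ k, rs k ∈ box (d + 1) Lc) (hM' : ∀ i, Lc ∣ M' i)
    {Q₁₀ : Matrix (↥(pbox M') × Fin (d + 1)) (↥(pbox (towerTorus Lc M' (n + 1))) × Fin (d + 1)) ℝ}
    {τ₁ : Matrix (NParam Lc (fine Lc M') (fun k => rs (k + 1)) n) (↥(pbox (towerTorus Lc M' (n + 1))) × Fin (d + 1)) ℝ}
    (hQ₁₀ : Q₁₀ = compRowsG Lc Q M' lev rs (n + 1))
    (hτ₁ : τ₁ = nestedSliceG Lc Q (fine Lc M') (fun k => lev (k + 1)) (fun k => rs (k + 1)) n)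
    {τ₂ : Matrix (Res (toSite (rs 0)) Lc M') (↥(pbox M') × Fin (d + 1)) ℝ} (hτ₂ : τ₂ = combF Lc M' (rs 0))
    {W₀ : Matrix (↥(pbox (towerTorus Lc M' (n + 1))) × Fin (d + 1)) (NParam Lc M' rs (n + 1)) ℝ} (hW₀ : W₀ = towerGen Lc M' rs (n + 1)) :
    (Matrix.fromRows (τ₂ * Q₁₀) τ₁ * W₀).det ≠ 0 := by
  subst hQ₁₀ hτ₁ hτ₂ hW₀
  exact det_nestedSliceG_mul_towerGen_ne_zero Lc Q σ hσ hc0 (n + 1) M' lev rs hrs hM'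

end Generic

/-! ## §2 The same induction at ONE constant comb-root list (a root-free kernel whose combs sit at one in-block offset `r`) -/

section Const

variable (Lc : ℕ) [NeZero Lc] (Q : StepRows d Lc) (σ : (ℕ → ℕ) → ℕ → ℝ) (hσ : ∀ lev m, σ lev m ≠ 0)
  (r : Fin (d + 1) → ℕ) (hr : r ∈ box (d + 1) Lc)
  (hc0r : ∀ (n : ℕ) (M : Fin (d + 1) → ℕ) [∀ μ, NeZero (M μ)] (lev : ℕ → ℕ),
    compRowsG Lc Q M lev (fun _ => r) (n + 1) * towerGen Lc M (fun _ => r) (n + 1)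
      = Matrix.fromCols
          (σ lev (n + 1) • (tgrad M).submatrix (fun a : ↥(pbox M) × Fin (d + 1) => ((a.1, Sum.inl a.2) : Idx M (Fib d)))
            (fun t : Res (toSite r) Lc M => (t.1 : ↥(pbox M))))
          (0 : Matrix (↥(pbox M) × Fin (d + 1)) (NParam Lc (fine Lc M) (fun _ => r) n) ℝ))
include hσ hr hc0r

/-- [folklore] **`hTW^{(n)}` OVER `Q` AT ONE CONSTANT ROOT LIST** — for ANY step-row family `Q` whose composite rows obey the covariance row `c0` along the comb
geometry rooted at ONE in-block offset `r` at every storey (`hc0r` — the CONSTANT-LIST row, displayed; `hr`; `σ` non-vanishing — `hσ`): `det (nestedSliceG Lc Q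
M lev (fun _ => r) n * towerGen Lc M (fun _ => r) n) ≠ 0` at every depth (`Lc ∣ M i`).  §1's induction VERBATIM at `rs := fun _ => r`: the tail of the constant
list is the constant list (up to `β`), so the induction hypothesis and the displayed row are read at the same list at every storey — exactly what a root-free
kernel supplies (§3), and nothing universal in the root list is asked. -/
theorem det_nestedSliceG_mul_towerGen_ne_zero_const :
    ∀ (n : ℕ) (M : Fin (d + 1) → ℕ) [∀ μ, NeZero (M μ)] (lev : ℕ → ℕ),
      (∀ i, Lc ∣ M i) → (nestedSliceG Lc Q M lev (fun _ => r) n * towerGen Lc M (fun _ => r) n).det ≠ 0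
  | 0, M, _, lev, hM =>
    det_ne_zero_of_abs_det (abs_det_combF_mul_tgrad_res_eq_one Lc M hr hM) one_ne_zero
  | n + 1, M, _, lev, hM => by
    have ih := det_nestedSliceG_mul_towerGen_ne_zero_const n (fine Lc M) (fun k => lev (k + 1)) (dvd_fine M)
    have htop := det_combF_mul_smul_tgrad_res_ne_zero Lc M hr hM (hσ lev (n + 1))
    have c0 := hc0r n M lev
    exact det_nestedSlice_mul_gauge_ne_zero
      (nestedSliceG Lc Q (fine Lc M) (fun k => lev (k + 1)) (fun _ => r) n) (combF Lc M r) (compRowsG Lc Q M lev (fun _ => r) (n + 1))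
      (towerGen Lc (fine Lc M) (fun _ => r) n)
      ((tgradBlock M (bigRatio Lc n)).submatrix
        (fun b : ↥(pbox (towerTorus Lc (fine Lc M) n)) × Fin (d + 1) =>
          ((pboxCongr (towerTorus_fine_eq_fine Lc M n) b.1, Sum.inl b.2) : Idx (fine (bigRatio Lc n) M) (Fib d)))
        (Subtype.val : Res (toSite r) Lc M → ↥(pbox M)))
      (σ lev (n + 1) • (tgrad M).submatrix (fun a : ↥(pbox M) × Fin (d + 1) => ((a.1, Sum.inl a.2) : Idx M (Fib d)))
          (fun t : Res (toSite r) Lc M => (t.1 : ↥(pbox M))))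
      (Matrix.ext fun a y => congrFun (congrFun c0 a) (Sum.inr y))
      (Matrix.ext fun a t => congrFun (congrFun c0 a) (Sum.inl t))
      rfl rfl (abs_ne_zero.mpr ih) (abs_ne_zero.mpr htop)

/-- [folklore] **`hTW` OF THE GENERIC COMPOSITE CALL AT A CONSTANT ROOT LIST, BINDERS VERBATIM UP TO `G`** (`hQ₁₀ hτ₁ hτ₂ hW₀` at `rs := fun _ => r`):
`(fromRows (τ₂ * Q₁₀) τ₁ * W₀).det ≠ 0`. -/
theorem torus_hTW_towerG_const (M' : Fin (d + 1) → ℕ) [∀ μ, NeZero (M' μ)] (lev : ℕ → ℕ) (n : ℕ) (hM' : ∀ i, Lc ∣ M' i)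
    {Q₁₀ : Matrix (↥(pbox M') × Fin (d + 1)) (↥(pbox (towerTorus Lc M' (n + 1))) × Fin (d + 1)) ℝ}
    {τ₁ : Matrix (NParam Lc (fine Lc M') (fun _ => r) n) (↥(pbox (towerTorus Lc M' (n + 1))) × Fin (d + 1)) ℝ}
    (hQ₁₀ : Q₁₀ = compRowsG Lc Q M' lev (fun _ => r) (n + 1))
    (hτ₁ : τ₁ = nestedSliceG Lc Q (fine Lc M') (fun k => lev (k + 1)) (fun _ => r) n)
    {τ₂ : Matrix (Res (toSite r) Lc M') (↥(pbox M') × Fin (d + 1)) ℝ} (hτ₂ : τ₂ = combF Lc M' r)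
    {W₀ : Matrix (↥(pbox (towerTorus Lc M' (n + 1))) × Fin (d + 1)) (NParam Lc M' (fun _ => r) (n + 1)) ℝ} (hW₀ : W₀ = towerGen Lc M' (fun _ => r) (n + 1)) :
    (Matrix.fromRows (τ₂ * Q₁₀) τ₁ * W₀).det ≠ 0 := by
  subst hQ₁₀ hτ₁ hτ₂ hW₀
  exact det_nestedSliceG_mul_towerGen_ne_zero_const Lc Q σ hσ r hr hc0r (n + 1) M' lev hM'

end Const

/-! ## §3 The (0.4)-symmetrised instance at the CENTRED comb-root list (the sym covariance row displayed — leaf-02's R-20, W-1's shape) -/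

section Sym

variable (Lc : ℕ) [NeZero Lc]
  (hc0 : ∀ (n : ℕ) (M : Fin (d + 1) → ℕ) [∀ μ, NeZero (M μ)] (lev : ℕ → ℕ),
    compRowsSym Lc M lev (fun _ => ctrOff (d + 1) Lc) (n + 1) * towerGen Lc M (fun _ => ctrOff (d + 1) Lc) (n + 1)
      = Matrix.fromCols
          ((∏ i ∈ range (n + 1), (stepScale d Lc (lev (i + 1)) * ((box (d + 1) Lc).card : ℝ))) •
            (tgrad M).submatrix (fun a : ↥(pbox M) × Fin (d + 1) => ((a.1, Sum.inl a.2) : Idx M (Fib d)))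
              (fun t : Res (toSite (ctrOff (d + 1) Lc)) Lc M => (t.1 : ↥(pbox M))))
          (0 : Matrix (↥(pbox M) × Fin (d + 1)) (NParam Lc (fine Lc M) (fun _ => ctrOff (d + 1) Lc) n) ℝ))
include hc0

/-- [folklore] **`hTW^{(n)}` FOR THE (0.4)-SYMMETRISED TOWER AT THE CENTRED ROOTS**: `det (nestedSliceSym Lc M lev (fun _ => ctrOff (d+1) Lc) n * towerGen Lc M
(fun _ => ctrOff (d+1) Lc) n) ≠ 0` at every depth, GIVEN leaf-02's sym c0 at the centred root list `hc0` (`compRowsSym … (n+1) * towerGen … (n+1) = fromCols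
(σ_{n+1} • D̄) 0`, `σ_{n+1} = ∏_{i<n+1} stepScale d Lc (lev (i+1)) · #B`; leaf-02 g31 W-1's shape — the root-free kernel `QstepSym`'s combs ARE centred, so
c0 is asked only there) — §2 at `Q := QSym Lc`, `r := ctrOff (d+1) Lc` (in-block: `ctrOff_mem_box`). -/
theorem det_nestedSliceSym_mul_towerGen_ne_zero (n : ℕ) (M : Fin (d + 1) → ℕ) [∀ μ, NeZero (M μ)] (lev : ℕ → ℕ) (hM : ∀ i, Lc ∣ M i) :
    (nestedSliceSym Lc M lev (fun _ => ctrOff (d + 1) Lc) n * towerGen Lc M (fun _ => ctrOff (d + 1) Lc) n).det ≠ 0 :=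
  det_nestedSliceG_mul_towerGen_ne_zero_const Lc (QSym Lc)
    (fun lev m => ∏ i ∈ range m, (stepScale d Lc (lev (i + 1)) * ((box (d + 1) Lc).card : ℝ)))
    (fun lev m => prod_stepScale_mul_card_ne_zero Lc lev m) (ctrOff (d + 1) Lc)
    (ctrOff_mem_box (d := d + 1) (Nat.one_le_iff_ne_zero.mpr (NeZero.ne Lc))) hc0 n M lev hM

/-- [folklore] **`hTW` OF THE (0.4)-SYMMETRISED COMPOSITE CALL AT THE CENTRED ROOTS, BINDERS VERBATIM** (`hQ₁₀ : Q₁₀ = compRowsSym …`, `hτ₁ : τ₁ = nestedSliceSym …`,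
`hτ₂ : τ₂ = combF Lc M′ (ctrOff (d+1) Lc)`, `hW₀`). -/
theorem torus_hTW_towerSym (M' : Fin (d + 1) → ℕ) [∀ μ, NeZero (M' μ)] (lev : ℕ → ℕ) (n : ℕ) (hM' : ∀ i, Lc ∣ M' i)
    {Q₁₀ : Matrix (↥(pbox M') × Fin (d + 1)) (↥(pbox (towerTorus Lc M' (n + 1))) × Fin (d + 1)) ℝ}
    {τ₁ : Matrix (NParam Lc (fine Lc M') (fun _ => ctrOff (d + 1) Lc) n) (↥(pbox (towerTorus Lc M' (n + 1))) × Fin (d + 1)) ℝ}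
    (hQ₁₀ : Q₁₀ = compRowsSym Lc M' lev (fun _ => ctrOff (d + 1) Lc) (n + 1))
    (hτ₁ : τ₁ = nestedSliceSym Lc (fine Lc M') (fun k => lev (k + 1)) (fun _ => ctrOff (d + 1) Lc) n)
    {τ₂ : Matrix (Res (toSite (ctrOff (d + 1) Lc)) Lc M') (↥(pbox M') × Fin (d + 1)) ℝ} (hτ₂ : τ₂ = combF Lc M' (ctrOff (d + 1) Lc))
    {W₀ : Matrix (↥(pbox (towerTorus Lc M' (n + 1))) × Fin (d + 1)) (NParam Lc M' (fun _ => ctrOff (d + 1) Lc) (n + 1)) ℝ}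
    (hW₀ : W₀ = towerGen Lc M' (fun _ => ctrOff (d + 1) Lc) (n + 1)) :
    (Matrix.fromRows (τ₂ * Q₁₀) τ₁ * W₀).det ≠ 0 := by
  subst hQ₁₀ hτ₁ hτ₂ hW₀
  exact det_nestedSliceSym_mul_towerGen_ne_zero Lc hc0 (n + 1) M' lev hM'

end Sym

end Summit.QuantumFields.BalabanUV.Beta.FP.TorusCompositeSliceG

end
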